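import Summits.Ventures.HSemireg.WedgeWeilOneSided
import Summits.Ventures.HSemireg.WedgeHankelDual

/-!
# Venture HSemireg — THEOREM R-B for asymmetric signatures (p + p ≠ N), every degree

HONEST FRAMING. Part of the Lean index of the computation cell `pub-hsemireg` (second enclosure wave, cut by seat p6 in the
conventions of seat p3's ENCLOSURE-PLAN-p3.md / build.py from th-7's kernel assets).  Finite-dimensional exterior algebra over a field ONLY:
no variety, no cohomology theory, no semiregularity map is constructed here; nothing here says that HC / HC_CM / HC_AV holds;
no Literature fact is declared or used.  The geometric DICTIONARY (why these ranks are the `HT`-side box ranks of the cell's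
STRUCTURE.md §1 / theory/FORMULA-N.md) lives in theory/FORMULA-N-th7.md PART B §A.3 / §N and is NOT asserted in Lean.

th-7's PART R4 — THEOREM R-B FOR ASYMMETRIC SIGNATURES IN EVERY DEGREE (theory/th7/WeilPurity.lean v6 sha256/16 32700a71e785aa92 (th-7 g6, 23:55Z 2026-08-22; = v5 4d7ab5385cc785fa + PART G two-zero corollaries + PART W3 (= v5.1 f732a146a33beda5) + PART R4; ×2 farm + negative controls + numerics at p6 g7), the block appended after PART W3),
VERBATIM up to the namespace (`HSemiregWeil` ↦ `Summit.Ventures.HSemireg.Wedge.Weil`, as the nine `WedgeWeil*.lean` files of wave 1): when the signature is NOT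
`(n,n)` (`p + p ≠ N`) the three summands of `θ ∧ v` live in three distinct degrees, so `θ ∧ v = 0` separates in EVERY degree `m` (`separation_asym` — uses HankelRank's `mul_mem_Hom`, carried by `WedgeHankelDual.lean` —, `ker_eq_asym`)
and PART R2's count goes through verbatim: **`weilRank_asym`** — for `p ≤ N`, `p + p ≠ N`, `1 ≤ m`, `ab ≠ 0`, ANY `q`, ANY field,
`finrank range(θ ↦ θ ∧ v ∣ ⋀^m) + (C(p,m) + C(N−p,m))·ρ_m = C(2p,m) + C(2N−2p,m) + C(N,m)·ρ_m`, `ρ_m = rank H_m(q)`; `weilRank_asym_five_two` (= 33 at (5,2), m = 2, ρ₂ = 2).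
Reading: the purity coupling of the `(n,n)` case is a degree coincidence (`N = 2p`); off it there is no exceptional locus in any degree.
-/

open Module Set Set.powersetCard

/-! ## PART R4 (th-7 g6, 2026-08-22T23:55Z): ASYMMETRIC SIGNATURES — THEOREM R-B IN EVERY DEGREE WHEN `2p ≠ N`.
PART R2's `weilRank_deg` needs `m + 1 ≤ N − p` because its K-WEIGHT separation fails from the middle degree on; but when the
signature is NOT `(n,n)` the three summands of `θ ∧ v` (`θ ∈ ⋀^m`) — `θ ∧ f ∈ ⋀^{m+N}`, `θ ∧ w₊ ∈ ⋀^{m+2(N−p)}`, `θ ∧ w₋ ∈ ⋀^{m+2p}` —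
live in three DISTINCT DEGREES of the exterior algebra, so `θ ∧ v = 0` forces all three to vanish in EVERY degree `m` (`separation_asym`),
and PART R2's count goes through verbatim: **`weilRank_asym`** — for `p ≤ N`, `p + p ≠ N`, `1 ≤ m`, `ab ≠ 0`, ANY `q`, ANY field,
`finrank range(θ ↦ θ ∧ v ∣ ⋀^m) + (C(p,m) + C(N−p,m))·ρ_m = C(2p,m) + C(2N−2p,m) + C(N,m)·ρ_m`, `ρ_m = rank H_m(q)`.
Reading (FORMULA-N PART B §L.5 / purity_table (b) of th-7 g4: «asymmetric signatures (5,2), (5,3), (6,2), (7,3): no purity drop anywhere»):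
the purity coupling of the `(n,n)` case is a DEGREE COINCIDENCE (`N = 2p`); off it there is no exceptional locus in any degree. Nothing here
bears on HC / HC_CM / HC_AV. -/

namespace Summit.Ventures.HSemireg.Wedge.Weil

open Module Summit.Ventures.HSemireg.Wedge.Hankel

variable (K : Type*) [Field K] {N : ℕ}

/-- DEGREE SEPARATION (`p + p ≠ N`, every `m`): `θ ∧ v = 0` with `θ ∈ ⋀^m` forces `θ ∧ f = 0`, `θ ∧ w₊ = 0` (if `a ≠ 0`),
`θ ∧ w₋ = 0` (if `b ≠ 0`). -/
lemma separation_asym {m p : ℕ} (hp : p ≤ N) (hpN : p + p ≠ N) (q : ℕ → K) {a b : K} {θ : HT K (In N)}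
    (hθ : θ ∈ Hom K (In N) Finset.univ m) (h0 : θ * vW K N p q a b = 0) :
    θ * w K N N q = 0 ∧ (a ≠ 0 → θ * B K (In N) (Gm N p) = 0) ∧ (b ≠ 0 → θ * B K (In N) (Dm N p) = 0) := by
  classical
  have e0 : θ * w K N N q ∈ Hom K (In N) Finset.univ (m + N) :=
    mul_mem_Hom K hθ (Hom_mono K (Finset.subset_univ _) N (w_mem_Hom K le_rfl q))
  have e1 : θ * B K (In N) (Gm N p) ∈ Hom K (In N) Finset.univ (m + ((N + N) - (p + p))) := by
    have := mul_B_mem_Hom K (Finset.Subset.refl _) (Finset.subset_univ (Gm N p)) hθ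
    rwa [card_Gm hp] at this
  have e2 : θ * B K (In N) (Dm N p) ∈ Hom K (In N) Finset.univ (m + (p + p)) := by
    have := mul_B_mem_Hom K (Finset.Subset.refl _) (Finset.subset_univ (Dm N p)) hθ
    rwa [card_Dm hp] at this
  rw [Hom_univ_eq_Sp] at e0 e1 e2
  rw [vW_mul_expand] at h0
  have d01 : ∀ s, Degm N (m + N) s → ¬ Degm N (m + ((N + N) - (p + p))) s :=
    fun s h1 h2 => by unfold Degm at h1 h2; omega
  have d02 : ∀ s, Degm N (m + N) s → ¬ Degm N (m + (p + p)) s :=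
    fun s h1 h2 => by unfold Degm at h1 h2; omega
  have d12 : ∀ s, Degm N (m + ((N + N) - (p + p))) s → ¬ Degm N (m + (p + p)) s :=
    fun s h1 h2 => by unfold Degm at h1 h2; omega
  refine ⟨?_, ?_, ?_⟩
  · have := congrArg (proj (K := K) (Degm N (m + N))) h0
    rwa [map_add, map_add, map_smul, map_smul, map_zero, proj_eq_self (fun s h => h) e0,
      proj_eq_zero (fun s h => fun h' => d01 s h' h) e1, proj_eq_zero (fun s h => fun h' => d02 s h' h) e2,
      smul_zero, smul_zero, add_zero, add_zero] at this
  · intro ha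
    have := congrArg (proj (K := K) (Degm N (m + ((N + N) - (p + p))))) h0
    rwa [map_add, map_add, map_smul, map_smul, map_zero, proj_eq_zero d01 e0, proj_eq_self (fun s h => h) e1,
      proj_eq_zero (fun s h => fun h' => d12 s h' h) e2, smul_zero, zero_add, add_zero, smul_eq_zero,
      or_iff_right ha] at this
  · intro hb
    have := congrArg (proj (K := K) (Degm N (m + (p + p)))) h0
    rwa [map_add, map_add, map_smul, map_smul, map_zero, proj_eq_zero d02 e0,
      proj_eq_zero d12 e1, proj_eq_self (fun s h => h) e2, smul_zero, zero_add,
      zero_add, smul_eq_zero, or_iff_right hb] at this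

/-- the kernel of `∧v` on `⋀^m` is the kernel of `∧f` on the MIXED monomials — every `m`, when `p + p ≠ N`. -/
theorem ker_eq_asym {m p : ℕ} (hp : p ≤ N) (hpN : p + p ≠ N) (q : ℕ → K) {a b : K} (ha : a ≠ 0) (hb : b ≠ 0) :
    Hom K (In N) Finset.univ m ⊓ LinearMap.ker (LinearMap.mulRight K (vW K N p q a b)) =
      Mm K N m p ⊓ LinearMap.ker (LinearMap.mulRight K (w K N N q)) := by
  ext θ
  simp only [Submodule.mem_inf, LinearMap.mem_ker, LinearMap.mulRight_apply]
  constructor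
  · rintro ⟨hθ, h0⟩
    obtain ⟨hf, hmx, hd⟩ := separation_asym K hp hpN q hθ h0
    exact ⟨mem_Mm_of_mul_blocks_eq_zero K hθ (hmx ha) (hd hb), hf⟩
  · rintro ⟨hθ, h0⟩
    obtain ⟨hmx, hd⟩ := mul_blocks_eq_zero_of_mem_Mm K hθ
    refine ⟨Mm_le_Hom K m p hθ, ?_⟩
    rw [vW_mul_expand, h0, hmx, hd, smul_zero, smul_zero, add_zero, add_zero]

/-- **THEOREM R-B FOR ASYMMETRIC SIGNATURES, EVERY DEGREE** (`p ≤ N`, `p + p ≠ N`, `1 ≤ m`, `ab ≠ 0`, ANY `q`, ANY field):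
`finrank range(θ ↦ θ ∧ v ∣ ⋀^m) + (C(p,m) + C(N−p,m))·ρ_m = C(2p,m) + C(2N−2p,m) + C(N,m)·ρ_m` — the `weilRank_deg` formula with NO
degree restriction: no purity locus in any degree off the `(n,n)` signature. -/
theorem weilRank_asym {m p : ℕ} (hm1 : 1 ≤ m) (hp : p ≤ N) (hpN : p + p ≠ N) (q : ℕ → K) {a b : K} (ha : a ≠ 0)
    (hb : b ≠ 0) :
    Module.finrank K (LinearMap.range (wedge K N m (vW K N p q a b))) +
        (p.choose m + (N - p).choose m) * (hankel1 K N m q).rank =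
      (p + p).choose m + ((N + N) - (p + p)).choose m + N.choose m * (hankel1 K N m q).rank := by
  have H1 := finrank_eq_map_add_inf_ker K (Hom K (In N) Finset.univ m) (LinearMap.mulRight K (vW K N p q a b))
  have H2 := finrank_eq_map_add_inf_ker K (Mm K N m p) (LinearMap.mulRight K (w K N N q))
  rw [ker_eq_asym K hp hpN q ha hb, finrank_Hom_univ, ← range_wedge] at H1
  rw [finrank_map_f_Mm K q] at H2
  have hM := finrank_Mm K (m := m) hm1 hp
  have hMX := card_MXm (N := N) (m := m) hm1 hp
  have hI : N.choose m * (hankel1 K N m q).rank =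
      (MXm N m p).card * (hankel1 K N m q).rank + (p.choose m + (N - p).choose m) * (hankel1 K N m q).rank := by
    rw [← hMX]; ring
  omega

/-- the `(5,2)` numbers of th-7 g4's purity_table at the would-be purity degree `m = 2` with `ρ₂ = 2`:
`rank + (C(2,2) + C(3,2))·2 = C(4,2) + C(6,2) + C(5,2)·2`, i.e. `rank = 6 + 15 + 2·(10 − 1 − 3) = 33`. -/
theorem weilRank_asym_five_two (q : ℕ → K) {a b : K} (ha : a ≠ 0) (hb : b ≠ 0) (hρ : (hankel1 K 5 2 q).rank = 2) :
    Module.finrank K (LinearMap.range (wedge K 5 2 (vW K 5 2 q a b))) = 33 := by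
  have h := weilRank_asym K (N := 5) (p := 2) (m := 2) (by norm_num) (by norm_num) (by norm_num) q ha hb
  rw [hρ] at h
  have e1 : (2 : ℕ).choose 2 = 1 := by decide
  have e2 : (5 - 2 : ℕ).choose 2 = 3 := by decide
  have e3 : (2 + 2 : ℕ).choose 2 = 6 := by decide
  have e4 : ((5 + 5) - (2 + 2) : ℕ).choose 2 = 15 := by decide
  have e5 : (5 : ℕ).choose 2 = 10 := by decide
  rw [e1, e2, e3, e4, e5] at h
  omega

end Summit.Ventures.HSemireg.Wedge.Weil
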